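import Summits.CriticalPhenomena.PercolationContinuityZ3.Theorems.PercNearOneGluingNoHeavyQuantHalfPairCatHull
import HarnessLib

/-!
# QUANT lane R8, T-DEC: THE LIGHT GLUED PAIR — CLOSED-FORM COLUMN KIT (census-2 g76, part 1 of 2)
# `T = (R¹[q](R^c[s]))²` at its natural LIGHT floor `y = q·s < 1/2`: value form, mean, and the six closed-form caterpillar columns
# (`A`, `E`, `B`, `Z`, `Lt`, `C`) with their `CatBuilt` derivations and means; part 2 (`…QuantLightPairCatHull`) assembles the certificates

builds on p205010 (kernel theorem, internal audit signed; external expert review pending)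

Support file (`--supports stmt-CriticalPhenomena-4575`), QUANT lane census seat prim-quant-census-2 (gen 76), rung R8 of
`run/shared/lean/prim/quant/LADDER.md`.  Definitions of concrete (parametric) laws only; theorems with standard axioms, no sorries.

WHAT.  The light node `TreeBuiltCatHullLight` (✓ p419856) / its core `CatPairLight` (✓ p424685) ask that products of gated caterpillars at a
LIGHT floor be finite mixtures of gated caterpillar laws of the same mean.  The simplest genuinely light interacting family is the GLUED PAIR
`T = t ∗ t`, `t = R¹[q](R^c[s]) = gate_q(δ₁ ∗ blob(c, s))`, floor `y = q·s < 1/2`, top `2c + 2`, mean `m = 2q(1 + c s)` — census-2 g75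
FREEHULL-G75 §6.3 ("a closed form here is the base case of any inductive proof of (P)"); the census engine needed 4–5 re-tuned columns per
instance and no pattern was known.  Census-2 g76 found (exact LP over a dictionary of closed-form columns, then by hand) that on an explicit
open region of `(q, s)` — for EVERY `c` — FIVE closed-form columns suffice:
  `T = (1−q)·gate_q(δ₂ ∗ blob(c,s)²)  +  W_E·[δ₂ ∗ blob(c, g_E)]  +  W_B·[δ₁ ∗ gate_β(δ₁ ∗ blob(2c, y/β))]  +  W_Z·[δ₁ ∗ gate_{a₁}(δ_{c+1} ∗ blob(c, y/a₁))]  +  W_X·X`,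
  `β = 2q − 1`, `g_E = 2qs − 2(1−q)/c`, `a₁ = (β + c y)/(c + 1)`, `X` one of `δ₁ ∗ blob(c, (m−1)/c)` / `δ₁ ∗ gate_σ(δ_c ∗ blob(1, y/σ))`,
  `σ = (m − 1 − y)/c` / `δ_{c+1} ∗ Bern(m − 1 − c)`, with closed-form rational weights (part 2).
The structure: `(1−q)·gate_q(ρ∗ρ)` peels the all-closed atom (FREEHULL-G75 §4c), after which the residual has a sure root relay; its five atoms are
served by two floor-TIGHT depth-1 caterpillars (`B`: merged `2c`-blob; `Z`: merged `(c+1)`-block — the "relay merging" of §4b), one blob forest `E`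
and one atom-`c` column `X`.  This file is the kernel transcription of the columns, parametrised by their gates (hypotheses = the floor conditions):
* `lpT c q s` (the pair law), `lpT_apply` (value form), `lpT_eq_zero`, `lpT_mean`;
* columns `lpColA c s`, `lpColE c g`, `lpColB c b g`, `lpColZ c a g`, `lpColL c g`, `lpColLt c σ p`, `lpColC c p` — each with `_apply` (value form),
  `cat_…` (explicit `CatBuilt` derivation at the floor, side conditions as hypotheses) and `_mean`.
HONEST STATUS.  Infrastructure for part 2; instances only (a 2–3-parameter family per `c`), not the node; `TreeBuiltCatHullLight`, `CatPairLight`,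
`SiblingStep`, `FarTreeRow` remain OPEN; RATE class log\* / honest sentence of `run/shared/lean/prim/quant/README.md` unchanged.  [this work];
census: prim-quant-census-2 g75/g76 (memo `run/shared/lean/prim/quant/prim-quant-census-2-g76/LIGHTPAIR-G76.md`, scripts `work/lightpair_*.py`).
Nothing here is cited as a published result.  The gluing rows served [cite: KozmaNitzan2024, Conjecture 3 (p. 15)]; product measure
[cite: Grimmett1999, §1.3 p. 10].
-/

noncomputable section

open scoped BigOperators

namespace Summit.CriticalPhenomena.PercolationContinuityZ3.Theorems
namespace Quant
namespace LawDec

open Finset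

/-! ### Point-mass bookkeeping (the rest is in `…QuantHalfPairCatHull`) -/

/-- one blob on a point mass: `slice δ_n a g = (1−g)·δ_n + g·δ_{n+a}`. [folklore] -/
theorem lp_slice_pointLaw (n a : ℕ) (g : ℝ) (h : ℕ) : slice (pointLaw n) a g h = (1 - g) * pointLaw n h + g * pointLaw (a + n) h := by
  simp only [slice]; rw [halfPt_shift a n h]

/-! ### The light glued pair -/

/-- the glued sibling law `t = R¹[q](R^c[s]) = gate_q(δ₁ ∗ blob(c, s))` (marginals `q`, `q·s`; top `c + 1`). [this work] -/
def lpSib (c : ℕ) (q s : ℝ) : ℕ → ℝ := gate (slice (pointLaw 1) c s) q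

/-- **the light glued pair** `T = t ∗ t` on `{0..2c+2}` (natural floor `y = q·s`, mean `2q(1 + c s)`). [this work] -/
def lpT (c : ℕ) (q s : ℝ) : ℕ → ℝ := lconv (c + 1) (c + 1) (lpSib c q s) (lpSib c q s)

/-- value form of `t`: `(1−q)·δ₀ + q(1−s)·δ₁ + q s·δ_{c+1}`. [this work] -/
theorem lpSib_apply (c : ℕ) (q s : ℝ) (h : ℕ) :
    lpSib c q s h = (1 - q) * pointLaw 0 h + q * (1 - s) * pointLaw 1 h + q * s * pointLaw (c + 1) h := by
  simp only [lpSib, gate]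
  rw [lp_slice_pointLaw, gate_ite_eq_pointLaw]
  ring

/-- `t` vanishes above `c + 1`. [this work] -/
theorem lpSib_eq_zero (c : ℕ) (q s : ℝ) (h : ℕ) (hh : c + 1 < h) : lpSib c q s h = 0 := by
  rw [lpSib_apply]
  simp [pointLaw_apply, show h ≠ 0 by omega, show h ≠ 1 by omega, show h ≠ c + 1 by omega]

/-- **value form of the pair law**:
`T = (1−q)²δ₀ + 2q(1−q)(1−s)δ₁ + q²(1−s)²δ₂ + 2q(1−q)s·δ_{c+1} + 2q²s(1−s)·δ_{c+2} + q²s²·δ_{2c+2}`. [this work] -/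
theorem lpT_apply (c : ℕ) (q s : ℝ) (h : ℕ) :
    lpT c q s h = (1 - q) ^ 2 * pointLaw 0 h + 2 * q * (1 - q) * (1 - s) * pointLaw 1 h + q ^ 2 * (1 - s) ^ 2 * pointLaw 2 h +
      2 * q * (1 - q) * s * pointLaw (c + 1) h + 2 * q ^ 2 * s * (1 - s) * pointLaw (c + 2) h +
      q ^ 2 * s ^ 2 * pointLaw (2 * c + 2) h := by
  have eT : lpSib c q s = fun k => (1 - q) * pointLaw 0 k + q * (1 - s) * pointLaw 1 k + q * s * pointLaw (c + 1) k :=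
    funext fun k => lpSib_apply c q s k
  have hz : ∀ k, c + 1 < k → lpSib c q s k = 0 := lpSib_eq_zero c q s
  have step : lpT c q s h = (1 - q) * lconv (c + 1) (c + 1) (pointLaw 0) (lpSib c q s) h +
      q * (1 - s) * lconv (c + 1) (c + 1) (pointLaw 1) (lpSib c q s) h +
      q * s * lconv (c + 1) (c + 1) (pointLaw (c + 1)) (lpSib c q s) h := by
    unfold lpT
    conv_lhs => rw [show lconv (c + 1) (c + 1) (lpSib c q s) (lpSib c q s) h =
      lconv (c + 1) (c + 1) (fun k => (1 - q) * pointLaw 0 k + q * (1 - s) * pointLaw 1 k + q * s * pointLaw (c + 1) k)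
        (lpSib c q s) h by rw [← eT]]
    exact lconv_lin3_left (c + 1) (c + 1) _ _ _ _ _ _ (lpSib c q s) h
  rw [step, lconv_pointLaw_left' (c + 1) (c + 1) 0 _ (by omega) hz h, lconv_pointLaw_left' (c + 1) (c + 1) 1 _ (by omega) hz h,
    lconv_pointLaw_left' (c + 1) (c + 1) (c + 1) _ le_rfl hz h]
  have s0 : (if 0 ≤ h then lpSib c q s (h - 0) else 0) =
      (1 - q) * pointLaw 0 h + q * (1 - s) * pointLaw 1 h + q * s * pointLaw (c + 1) h := by
    rw [if_pos (Nat.zero_le h), Nat.sub_zero, lpSib_apply]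
  have s1 : (if 1 ≤ h then lpSib c q s (h - 1) else 0) =
      (1 - q) * pointLaw 1 h + q * (1 - s) * pointLaw 2 h + q * s * pointLaw (c + 2) h := by
    by_cases h1 : 1 ≤ h
    · rw [if_pos h1, lpSib_apply c q s (h - 1), halfPt_sub 1 0 h h1, halfPt_sub 1 1 h h1, halfPt_sub 1 (c + 1) h h1,
        show 1 + (c + 1) = c + 2 by omega]
    · rw [if_neg h1]
      have h0 : h = 0 := by omega
      subst h0
      simp [pointLaw_apply]
  have s2 : (if c + 1 ≤ h then lpSib c q s (h - (c + 1)) else 0) =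
      (1 - q) * pointLaw (c + 1) h + q * (1 - s) * pointLaw (c + 2) h + q * s * pointLaw (2 * c + 2) h := by
    by_cases h1 : c + 1 ≤ h
    · rw [if_pos h1, lpSib_apply c q s (h - (c + 1)), halfPt_sub (c + 1) 0 h h1, halfPt_sub (c + 1) 1 h h1,
        halfPt_sub (c + 1) (c + 1) h h1, Nat.add_zero, show c + 1 + 1 = c + 2 by omega,
        show c + 1 + (c + 1) = 2 * c + 2 by omega]
    · rw [if_neg h1]
      simp [pointLaw_apply, show h ≠ c + 1 by omega, show h ≠ c + 2 by omega, show h ≠ 2 * c + 2 by omega]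
  rw [s0, s1, s2]
  ring

/-- `T` vanishes above `2c + 2`. [this work] -/
theorem lpT_eq_zero (c : ℕ) (q s : ℝ) (h : ℕ) (hh : 2 * c + 2 < h) : lpT c q s h = 0 := lconv_eq_zero (c + 1) (c + 1) _ _ h (by omega)

/-- **mean of the pair law**: `Σ_{h ≤ 2c+2} h·T(h) = 2q(1 + c s)`. [this work] -/
theorem lpT_mean (c : ℕ) (q s : ℝ) : ∑ h ∈ Finset.range (2 * c + 2 + 1), (h : ℝ) * lpT c q s h = 2 * q * (1 + c * s) := by
  have e : ∀ h : ℕ, (h : ℝ) * lpT c q s h = (1 - q) ^ 2 * ((h : ℝ) * pointLaw 0 h) +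
      2 * q * (1 - q) * (1 - s) * ((h : ℝ) * pointLaw 1 h) + q ^ 2 * (1 - s) ^ 2 * ((h : ℝ) * pointLaw 2 h) +
      2 * q * (1 - q) * s * ((h : ℝ) * pointLaw (c + 1) h) + 2 * q ^ 2 * s * (1 - s) * ((h : ℝ) * pointLaw (c + 2) h) +
      q ^ 2 * s ^ 2 * ((h : ℝ) * pointLaw (2 * c + 2) h) := fun h => by rw [lpT_apply]; ring
  simp_rw [e]
  simp only [Finset.sum_add_distrib, ← Finset.mul_sum]
  rw [sum_mul_pointLaw 0 _ (by omega), sum_mul_pointLaw 1 _ (by omega), sum_mul_pointLaw 2 _ (by omega),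
    sum_mul_pointLaw (c + 1) _ (by omega), sum_mul_pointLaw (c + 2) _ (by omega), sum_mul_pointLaw (2 * c + 2) _ le_rfl]
  push_cast
  ring

/-! ### The six closed-form columns (inner laws; every gate a parameter) -/

/-- column `A` (inner law, outer gate `q`): the blob forest `δ₂ ∗ blob(c,s) ∗ blob(c,s)` (`= ρ ∗ ρ`, FREEHULL-G75 §4c). [this work] -/
def lpColA (c : ℕ) (s : ℝ) : ℕ → ℝ := slice (slice (slice (pointLaw 0) 2 1) c s) c s

/-- column `E`: the blob forest `δ₂ ∗ blob(c, g)`. [this work] -/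
def lpColE (c : ℕ) (g : ℝ) : ℕ → ℝ := slice (slice (pointLaw 0) 2 1) c g

/-- column `B`: the caterpillar `δ₁ ∗ gate_b(δ₁ ∗ blob(2c, g))` (the two `c`-blobs MERGED into one `2c`-blob under a gated relay). [this work] -/
def lpColB (c : ℕ) (b g : ℝ) : ℕ → ℝ := slice (gate (slice (slice (pointLaw 0) 1 1) (2 * c) g) b) 1 1

/-- column `Z`: the caterpillar `δ₁ ∗ gate_a(δ_{c+1} ∗ blob(c, g))` (relay and blob MERGED into one sure `(c+1)`-block under a gate). [this work] -/
def lpColZ (c : ℕ) (a g : ℝ) : ℕ → ℝ := slice (gate (slice (slice (pointLaw 0) (c + 1) 1) c g) a) 1 1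

/-- column `L`: the blob forest `δ₁ ∗ blob(c, g)`. [this work] -/
def lpColL (c : ℕ) (g : ℝ) : ℕ → ℝ := slice (slice (pointLaw 0) 1 1) c g

/-- column `Lt`: the caterpillar `δ₁ ∗ gate_σ(δ_c ∗ blob(1, p))`. [this work] -/
def lpColLt (c : ℕ) (σ p : ℝ) : ℕ → ℝ := slice (gate (slice (slice (pointLaw 0) c 1) 1 p) σ) 1 1

/-- column `C`: the blob forest `δ_{c+1} ∗ Bern(p)`. [this work] -/
def lpColC (c : ℕ) (p : ℝ) : ℕ → ℝ := slice (slice (pointLaw 0) (c + 1) 1) 1 p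

/-- value form of `A`: `(1−s)²δ₂ + 2s(1−s)δ_{c+2} + s²δ_{2c+2}`. [this work] -/
theorem lpColA_apply (c : ℕ) (s : ℝ) (h : ℕ) :
    lpColA c s h = (1 - s) ^ 2 * pointLaw 2 h + 2 * s * (1 - s) * pointLaw (c + 2) h + s ^ 2 * pointLaw (2 * c + 2) h := by
  rw [lpColA, slice_pointLaw_zero_one]
  have e1 : slice (pointLaw 2) c s = fun k => (1 - s) * pointLaw 2 k + s * pointLaw (c + 2) k := funext fun k => lp_slice_pointLaw 2 c s k
  rw [e1]
  simp only [slice]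
  by_cases hc : c ≤ h
  · rw [if_pos hc, halfPt_sub c 2 h hc, halfPt_sub c (c + 2) h hc, show c + (c + 2) = 2 * c + 2 by omega]; ring
  · rw [if_neg hc]
    simp only [pointLaw_apply, if_neg (show h ≠ c + 2 by omega), if_neg (show h ≠ 2 * c + 2 by omega)]
    split_ifs <;> ring

/-- value form of `E`: `(1−g)δ₂ + g·δ_{c+2}`. [this work] -/
theorem lpColE_apply (c : ℕ) (g : ℝ) (h : ℕ) : lpColE c g h = (1 - g) * pointLaw 2 h + g * pointLaw (c + 2) h := by
  rw [lpColE, slice_pointLaw_zero_one, lp_slice_pointLaw]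

/-- value form of `L`: `(1−g)δ₁ + g·δ_{c+1}`. [this work] -/
theorem lpColL_apply (c : ℕ) (g : ℝ) (h : ℕ) : lpColL c g h = (1 - g) * pointLaw 1 h + g * pointLaw (c + 1) h := by
  rw [lpColL, slice_pointLaw_zero_one, lp_slice_pointLaw]

/-- value form of `C`: `(1−p)δ_{c+1} + p·δ_{c+2}`. [this work] -/
theorem lpColC_apply (c : ℕ) (p : ℝ) (h : ℕ) : lpColC c p h = (1 - p) * pointLaw (c + 1) h + p * pointLaw (c + 2) h := by
  rw [lpColC, slice_pointLaw_zero_one, lp_slice_pointLaw, show 1 + (c + 1) = c + 2 by omega]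

/-- the shape shared by `B`, `Z`, `Lt`: `slice (gate (slice δ_n a g) b) 1 1 = (1−b)δ₁ + b(1−g)δ_{n+1} + b g·δ_{a+n+1}`. [this work] -/
theorem lp_cat2_apply (n a : ℕ) (b g : ℝ) (h : ℕ) :
    slice (gate (slice (pointLaw n) a g) b) 1 1 h =
      (1 - b) * pointLaw 1 h + b * (1 - g) * pointLaw (n + 1) h + b * g * pointLaw (a + n + 1) h := by
  have eG : ∀ k, gate (slice (pointLaw n) a g) b k =
      (1 - b) * pointLaw 0 k + b * (1 - g) * pointLaw n k + b * g * pointLaw (a + n) k := by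
    intro k
    simp only [gate]
    rw [lp_slice_pointLaw, gate_ite_eq_pointLaw]
    ring
  rw [show slice (gate (slice (pointLaw n) a g) b) 1 1 h =
    (1 - 1) * gate (slice (pointLaw n) a g) b h + 1 * (if 1 ≤ h then gate (slice (pointLaw n) a g) b (h - 1) else 0) from rfl]
  by_cases h1 : 1 ≤ h
  · rw [if_pos h1, eG (h - 1), halfPt_sub 1 0 h h1, halfPt_sub 1 n h h1, halfPt_sub 1 (a + n) h h1, Nat.add_zero,
      show 1 + n = n + 1 by omega, show 1 + (a + n) = a + n + 1 by omega]
    ring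
  · rw [if_neg h1]
    have h0 : h = 0 := by omega
    subst h0
    simp [pointLaw_apply]

/-- value form of `B`: `(1−b)δ₁ + b(1−g)δ₂ + b g·δ_{2c+2}`. [this work] -/
theorem lpColB_apply (c : ℕ) (b g : ℝ) (h : ℕ) :
    lpColB c b g h = (1 - b) * pointLaw 1 h + b * (1 - g) * pointLaw 2 h + b * g * pointLaw (2 * c + 2) h := by
  rw [lpColB, slice_pointLaw_zero_one, lp_cat2_apply, show 2 * c + 1 + 1 = 2 * c + 2 by omega]

/-- value form of `Z`: `(1−a)δ₁ + a(1−g)δ_{c+2} + a g·δ_{2c+2}`. [this work] -/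
theorem lpColZ_apply (c : ℕ) (a g : ℝ) (h : ℕ) :
    lpColZ c a g h = (1 - a) * pointLaw 1 h + a * (1 - g) * pointLaw (c + 2) h + a * g * pointLaw (2 * c + 2) h := by
  rw [lpColZ, slice_pointLaw_zero_one, lp_cat2_apply, show c + 1 + 1 = c + 2 by omega, show c + (c + 1) + 1 = 2 * c + 2 by omega]

/-- value form of `Lt`: `(1−σ)δ₁ + σ(1−p)δ_{c+1} + σ p·δ_{c+2}`. [this work] -/
theorem lpColLt_apply (c : ℕ) (σ p : ℝ) (h : ℕ) :
    lpColLt c σ p h = (1 - σ) * pointLaw 1 h + σ * (1 - p) * pointLaw (c + 1) h + σ * p * pointLaw (c + 2) h := by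
  rw [lpColLt, slice_pointLaw_zero_one, lp_cat2_apply, show 1 + c + 1 = c + 2 by omega]

/-! ### `CatBuilt` derivations (floor conditions as hypotheses) and means -/

/-- `A` is a blob forest at floor `s` (`0 < s < 1`), top `2c + 2`. [this work] -/
theorem cat_lpColA (c : ℕ) (s : ℝ) (hs0 : 0 < s) (hs1 : s < 1) : CatBuilt s (2 * c + 2) (lpColA c s) := by
  have h := (((CatBuilt.nil s hs0 hs1).slice 2 1 hs1.le le_rfl).slice c s le_rfl hs1.le).slice c s le_rfl hs1.le
  rw [show 2 * c + 2 = 0 + 2 + c + c by omega]; exact h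

/-- `E` is a blob forest at floor `y` whenever `y ≤ g ≤ 1`, top `c + 2`. [this work] -/
theorem cat_lpColE (c : ℕ) (y g : ℝ) (hy0 : 0 < y) (hy1 : y < 1) (hg : y ≤ g) (hg1 : g ≤ 1) : CatBuilt y (c + 2) (lpColE c g) := by
  have h := ((CatBuilt.nil y hy0 hy1).slice 2 1 hy1.le le_rfl).slice c g hg hg1
  rw [show c + 2 = 0 + 2 + c by omega]; exact h

/-- `L` is a blob forest at floor `y` whenever `y ≤ g ≤ 1`, top `c + 1`. [this work] -/
theorem cat_lpColL (c : ℕ) (y g : ℝ) (hy0 : 0 < y) (hy1 : y < 1) (hg : y ≤ g) (hg1 : g ≤ 1) : CatBuilt y (c + 1) (lpColL c g) := by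
  have h := ((CatBuilt.nil y hy0 hy1).slice 1 1 hy1.le le_rfl).slice c g hg hg1
  rw [show c + 1 = 0 + 1 + c by omega]; exact h

/-- `C` is a blob forest at floor `y` whenever `y ≤ p ≤ 1`, top `c + 2`. [this work] -/
theorem cat_lpColC (c : ℕ) (y p : ℝ) (hy0 : 0 < y) (hy1 : y < 1) (hp : y ≤ p) (hp1 : p ≤ 1) : CatBuilt y (c + 2) (lpColC c p) := by
  have h := ((CatBuilt.nil y hy0 hy1).slice (c + 1) 1 hy1.le le_rfl).slice 1 p hp hp1
  rw [show c + 2 = 0 + (c + 1) + 1 by omega]; exact h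

/-- the shared depth-1 caterpillar `slice (gate (slice δ_n a (y/b)) b) 1 1` is `CatBuilt y` when `0 < y < b ≤ 1` (tip floor `y/b`, the blob
FLOOR-TIGHT at `y/b`). [this work] -/
theorem cat_lp_cat2 (n a : ℕ) (y b : ℝ) (hy0 : 0 < y) (hyb : y < b) (hb1 : b ≤ 1) :
    CatBuilt y (n + a + 1) (slice (gate (slice (slice (pointLaw 0) n 1) a (y / b)) b) 1 1) := by
  have hb0 : 0 < b := hy0.trans hyb
  have hf0 : 0 < y / b := div_pos hy0 hb0
  have hf1 : y / b < 1 := (div_lt_one hb0).2 hyb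
  have h := ((((CatBuilt.nil (y / b) hf0 hf1).slice n 1 hf1.le le_rfl).slice a (y / b) le_rfl hf1.le).gate b hb0 hb1).slice 1 1
    (by rw [mul_div_cancel₀ _ hb0.ne']; exact (hyb.trans_le hb1).le) le_rfl
  rw [mul_div_cancel₀ _ hb0.ne', show 0 + n + a + 1 = n + a + 1 by omega] at h
  exact h

/-- `B` at floor `y`: `0 < y < b ≤ 1`, blob gate `y/b`; top `2c + 2`. [this work] -/
theorem cat_lpColB (c : ℕ) (y b : ℝ) (hy0 : 0 < y) (hyb : y < b) (hb1 : b ≤ 1) : CatBuilt y (2 * c + 2) (lpColB c b (y / b)) := by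
  have h := cat_lp_cat2 1 (2 * c) y b hy0 hyb hb1
  rw [slice_pointLaw_zero_one, show 1 + 2 * c + 1 = 2 * c + 2 by omega] at h
  rw [lpColB, slice_pointLaw_zero_one]; exact h

/-- `Z` at floor `y`: `0 < y < a ≤ 1`, blob gate `y/a`; top `2c + 2`. [this work] -/
theorem cat_lpColZ (c : ℕ) (y a : ℝ) (hy0 : 0 < y) (hya : y < a) (ha1 : a ≤ 1) : CatBuilt y (2 * c + 2) (lpColZ c a (y / a)) := by
  have h := cat_lp_cat2 (c + 1) c y a hy0 hya ha1
  rw [slice_pointLaw_zero_one, show c + 1 + c + 1 = 2 * c + 2 by omega] at h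
  rw [lpColZ, slice_pointLaw_zero_one]; exact h

/-- `Lt` at floor `y`: `0 < y < σ ≤ 1`, one-blob gate `y/σ`; top `c + 2`. [this work] -/
theorem cat_lpColLt (c : ℕ) (y σ : ℝ) (hy0 : 0 < y) (hyσ : y < σ) (hσ1 : σ ≤ 1) : CatBuilt y (c + 2) (lpColLt c σ (y / σ)) := by
  have h := cat_lp_cat2 c 1 y σ hy0 hyσ hσ1
  rw [slice_pointLaw_zero_one, show c + 1 + 1 = c + 2 by omega] at h
  rw [lpColLt, slice_pointLaw_zero_one]; exact h

/-- a three-point-mass law has the obvious first moment. [folklore] -/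
theorem lp_sum_mul_three (N n₁ n₂ n₃ : ℕ) (a₁ a₂ a₃ : ℝ) (h₁ : n₁ ≤ N) (h₂ : n₂ ≤ N) (h₃ : n₃ ≤ N) :
    ∑ h ∈ Finset.range (N + 1), (h : ℝ) * (a₁ * pointLaw n₁ h + a₂ * pointLaw n₂ h + a₃ * pointLaw n₃ h) =
      a₁ * n₁ + a₂ * n₂ + a₃ * n₃ := by
  have e : ∀ h : ℕ, (h : ℝ) * (a₁ * pointLaw n₁ h + a₂ * pointLaw n₂ h + a₃ * pointLaw n₃ h) =
      a₁ * ((h : ℝ) * pointLaw n₁ h) + a₂ * ((h : ℝ) * pointLaw n₂ h) + a₃ * ((h : ℝ) * pointLaw n₃ h) := fun h => by ring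
  simp_rw [e]
  rw [Finset.sum_add_distrib, Finset.sum_add_distrib, ← Finset.mul_sum, ← Finset.mul_sum, ← Finset.mul_sum,
    sum_mul_pointLaw n₁ _ h₁, sum_mul_pointLaw n₂ _ h₂, sum_mul_pointLaw n₃ _ h₃]

/-- mean of `A` after its outer gate `q`: `q·(2 + 2cs)`. [this work] -/
theorem lpColA_mean (c : ℕ) (q s : ℝ) :
    q * ∑ h ∈ Finset.range (2 * c + 2 + 1), (h : ℝ) * lpColA c s h = 2 * q * (1 + c * s) := by
  simp_rw [lpColA_apply]
  rw [lp_sum_mul_three _ 2 (c + 2) (2 * c + 2) _ _ _ (by omega) (by omega) le_rfl]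
  push_cast; ring

/-- mean of `E`: `2 + c g`. [this work] -/
theorem lpColE_mean (c : ℕ) (g : ℝ) : (1 : ℝ) * ∑ h ∈ Finset.range (c + 2 + 1), (h : ℝ) * lpColE c g h = 2 + c * g := by
  have e : ∀ h, lpColE c g h = (1 - g) * pointLaw 2 h + g * pointLaw (c + 2) h + 0 * pointLaw 0 h := fun h => by
    rw [lpColE_apply]; ring
  simp_rw [e]
  rw [lp_sum_mul_three _ 2 (c + 2) 0 _ _ _ (by omega) le_rfl (by omega)]
  push_cast; ring

/-- mean of `L`: `1 + c g`. [this work] -/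
theorem lpColL_mean (c : ℕ) (g : ℝ) : (1 : ℝ) * ∑ h ∈ Finset.range (c + 1 + 1), (h : ℝ) * lpColL c g h = 1 + c * g := by
  have e : ∀ h, lpColL c g h = (1 - g) * pointLaw 1 h + g * pointLaw (c + 1) h + 0 * pointLaw 0 h := fun h => by
    rw [lpColL_apply]; ring
  simp_rw [e]
  rw [lp_sum_mul_three _ 1 (c + 1) 0 _ _ _ (by omega) le_rfl (by omega)]
  push_cast; ring

/-- mean of `C`: `c + 1 + p`. [this work] -/
theorem lpColC_mean (c : ℕ) (p : ℝ) : (1 : ℝ) * ∑ h ∈ Finset.range (c + 2 + 1), (h : ℝ) * lpColC c p h = c + 1 + p := by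
  have e : ∀ h, lpColC c p h = (1 - p) * pointLaw (c + 1) h + p * pointLaw (c + 2) h + 0 * pointLaw 0 h := fun h => by
    rw [lpColC_apply]; ring
  simp_rw [e]
  rw [lp_sum_mul_three _ (c + 1) (c + 2) 0 _ _ _ (by omega) le_rfl (by omega)]
  push_cast; ring

/-- mean of `B`: `1 + b + 2c·b g`. [this work] -/
theorem lpColB_mean (c : ℕ) (b g : ℝ) :
    (1 : ℝ) * ∑ h ∈ Finset.range (2 * c + 2 + 1), (h : ℝ) * lpColB c b g h = 1 + b + 2 * c * (b * g) := by
  simp_rw [lpColB_apply]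
  rw [lp_sum_mul_three _ 1 2 (2 * c + 2) _ _ _ (by omega) (by omega) le_rfl]
  push_cast; ring

/-- mean of `Z`: `1 + a(c+1) + c·a g`. [this work] -/
theorem lpColZ_mean (c : ℕ) (a g : ℝ) :
    (1 : ℝ) * ∑ h ∈ Finset.range (2 * c + 2 + 1), (h : ℝ) * lpColZ c a g h = 1 + a * (c + 1) + c * (a * g) := by
  simp_rw [lpColZ_apply]
  rw [lp_sum_mul_three _ 1 (c + 2) (2 * c + 2) _ _ _ (by omega) (by omega) le_rfl]
  push_cast; ring

/-- mean of `Lt`: `1 + σ c + σ p`. [this work] -/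
theorem lpColLt_mean (c : ℕ) (σ p : ℝ) :
    (1 : ℝ) * ∑ h ∈ Finset.range (c + 2 + 1), (h : ℝ) * lpColLt c σ p h = 1 + σ * c + σ * p := by
  simp_rw [lpColLt_apply]
  rw [lp_sum_mul_three _ 1 (c + 1) (c + 2) _ _ _ (by omega) (by omega) le_rfl]
  push_cast; ring

end LawDec
end Quant
end Summit.CriticalPhenomena.PercolationContinuityZ3.Theorems
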